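import Summits.AtomisticToContinuum.FouriersLaw.Theses.CoercivePulse
import Summits.AtomisticToContinuum.FouriersLaw.Theorems.CageBudgetFeketeHeatVarianceCalculus
import Literature.MathematicalPhysics.KineticTheory.InfiniteChainGoodSetSymmetries
import HarnessLib

/-!
# `AbelRegularity` is ONE statement about the canonical pair at bath constant `1`
(crux `CoercivePulse.AbelRegularity`, item stmt-AtomisticToContinuum-15384, shared verbatim with
`HoelderEscapeProfile.AbelRegularity`; `--supports` helper file, closes nothing; line lead `Sketch`, continuation c1,
2026-08-17)

WHAT. Two transfer theorems that every positive attempt on the crux needs and that were so far only available in the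
crux disprover's workfile (`Cruxes/AbelRegularity/Disproof.lean` §0, `abelRegularity_iff_witness` / `guard_completion`,
refuter-cdisprove-stmt-AtomisticToContinuum-15384-0 — adapted here with credit, importable from `Theorems`):

* `abelRegularity_of_witness` — it suffices to exhibit, for each `(ω₂, lam, β, T)` (all `> 0`), SOME shift-invariant DLR
  state `μ` of `pinnedChain ω₂ lam β 1` and SOME `μ`-preserving dynamics `D` whose Abel means
  `∫₀^∞ e^{-νt} C_T(t) dt` converge in `ℝ` or tend to `+∞` as `ν ↓ 0`: the bath constant `γ` is inert for the
  infinite-volume objects (verbatim transport of the dynamics), the shift-invariant DLR state is unique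
  (`eq_of_isChainGibbsMeasure_of_isShiftInvariant_pinnedChain`) and any two `μ`-preserving dynamics are the canonical
  Buttà–Marchioro flow a.e. at all times (`HeatVarianceCalculus.CanonicalRigidity.flow_ae_eq_canonical`), hence have
  the same summed current autocorrelation; the momentum-reversal, a.e.-covariance, absolute-convergence and
  Laplace-integrability hypotheses of the crux are then simply discarded.
* `witness_of_abelRegularity` — conversely the crux yields such a witness (the transfer-operator state and the
  Buttà–Marchioro dynamics, whose four extra guard clauses hold: reversal invariance by uniqueness, covariance by
  `flow_comp_chainShift_ae_of_carrier_eq_bmGood`, absolute convergence and Laplace integrability by the landed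
  `heatVarianceCalculus_proof`), so `abelRegularity_iff_witness` records the equivalence.

The (R)-bridge `abelRegularity_of_uniformAbelianRegularity` (p172105) is the first client of this reduction; the
time-domain line `Sketch` (`stub_tameFilteredMemory`) would be the second.
-/

noncomputable section

namespace Summit.AtomisticToContinuum.FouriersLaw.Theorems.AbelRegularity.Sketch

open MeasureTheory Filter Set
open scoped Topology BigOperators
open Literature.MathematicalPhysics.KineticTheory.HeatConduction

/-- **Witness ⇒ crux.** If for every `ω₂, lam, β > 0` and `T > 0` some shift-invariant DLR state `μ` of
`pinnedChain ω₂ lam β 1` and some `μ`-preserving infinite-volume dynamics `D` have Abel means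
`∫₀^∞ e^{-νt} C_T(t) dt` converging in `ℝ` or tending to `+∞` as `ν ↓ 0`, then `CoercivePulse.AbelRegularity` holds
(for every bath constant `γ`, every guarded pair). Uniqueness of the shift-invariant DLR state + dynamics rigidity onto
the Buttà–Marchioro flow + transport to bath constant `1`.
-- adapted from Cruxes/AbelRegularity/Disproof.lean §0 (`abelRegularity_iff_witness`, ⇐), refuter-cdisprove seat.
[cite: ButtaMarchioro2016, §2 Thm 2.1 and eq. (2.6)] [cite: Georgii2011, Thm 10.25 and §11.1] -/
theorem abelRegularity_of_witness
    (h : ∀ ω₂ lam β : ℝ, 0 < ω₂ → 0 < lam → 0 < β → ∀ T : ℝ, 0 < T →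
      ∃ (μ : MeasureTheory.Measure ChainConfig) (D : InfiniteChainDynamics (pinnedChain ω₂ lam β 1)),
        (pinnedChain ω₂ lam β 1).IsChainGibbsMeasure T μ ∧ IsShiftInvariant μ ∧ D.PreservesMeasure μ ∧
        ((∃ L : ℝ, Tendsto (fun ν : ℝ => ∫ t in Ioi (0:ℝ), Real.exp (-(ν * t)) * D.currentCorrelation μ t)
            (𝓝[>] 0) (𝓝 L)) ∨
          Tendsto (fun ν : ℝ => ∫ t in Ioi (0:ℝ), Real.exp (-(ν * t)) * D.currentCorrelation μ t)
            (𝓝[>] 0) atTop)) :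
    _root_.Summit.AtomisticToContinuum.FouriersLaw.Theses.CoercivePulse.AbelRegularity := by
  intro ω₂ lam β γ hω hl hβ T hT μ hG hSI _ D hP _ _ _
  obtain ⟨μw, Dw, hGw, hSw, hPw, hdich⟩ := h ω₂ lam β hω hl hβ T hT
  -- transport the guarded dynamics to bath constant 1 (the infinite-volume objects do not see `γ`)
  let D₁ : InfiniteChainDynamics (pinnedChain ω₂ lam β 1) :=
    ⟨D.carrier, D.flow, D.mapsTo, D.flow_zero, D.isSolution, D.unique⟩
  have hG₁ : (pinnedChain ω₂ lam β 1).IsChainGibbsMeasure T μ := hG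
  have hP₁ : D₁.PreservesMeasure μ := hP
  have hcc₁ : ∀ t : ℝ, D.currentCorrelation μ t = D₁.currentCorrelation μ t := fun _ => rfl
  -- uniqueness of the shift-invariant DLR state
  obtain rfl : μ = μw :=
    OscillatorChain.eq_of_isChainGibbsMeasure_of_isShiftInvariant_pinnedChain 1 hω hl.le hβ.le hT hG₁ hSI hGw hSw
  -- rigidity: `D₁` and `Dw` are both the canonical Buttà–Marchioro flow a.e., at all times
  have hU2 : OscillatorChain.IsEvenPolyOfDegree (pinnedChain ω₂ lam β 1).U 2 :=
    OscillatorChain.pinnedChain_isEvenPolyOfDegree_U β 1 hω.le hl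
  have hV2 : OscillatorChain.IsEvenPolyOfDegree (pinnedChain ω₂ lam β 1).V 2 :=
    OscillatorChain.pinnedChain_isEvenPolyOfDegree_V ω₂ lam 1 hβ
  obtain ⟨D', hcar, -, -, -, -, -, -⟩ :=
    OscillatorChain.exists_bmDynamics (P := pinnedChain ω₂ lam β 1) (by norm_num) (by norm_num) hU2 hV2
  have hrig₁ := HeatVarianceCalculus.CanonicalRigidity.flow_ae_eq_canonical 1 hω hl hβ hT hG₁ hSI D₁ D' hP₁ hcar
  have hrigw := HeatVarianceCalculus.CanonicalRigidity.flow_ae_eq_canonical 1 hω hl hβ hT hG₁ hSI Dw D' hPw hcar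
  have hCC : ∀ t : ℝ, D₁.currentCorrelation μ t = Dw.currentCorrelation μ t := fun t => by
    unfold InfiniteChainDynamics.currentCorrelation
    refine tsum_congr fun x => integral_congr_ae ?_
    filter_upwards [hrig₁, hrigw] with σ h₁ h₂
    rw [h₁ t, h₂ t]
  have e : (fun ν : ℝ => ∫ t in Set.Ioi (0:ℝ), Real.exp (-(ν * t)) * D.currentCorrelation μ t) =
      fun ν : ℝ => ∫ t in Set.Ioi (0:ℝ), Real.exp (-(ν * t)) * Dw.currentCorrelation μ t := by
    funext ν
    simp only [hcc₁, hCC]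
  rw [e]
  exact hdich

/-- **Crux ⇒ witness.** `CoercivePulse.AbelRegularity` yields, for every `ω₂, lam, β > 0` and `T > 0`, a shift-invariant
DLR state of `pinnedChain ω₂ lam β 1` and a preserving dynamics with the Abel dichotomy: the transfer-operator state
and the Buttà–Marchioro dynamics, for which the crux's four extra guard clauses (momentum-reversal invariance, a.e.
shift-covariance, absolutely convergent summed correlations, Laplace integrability) are theorems in tree.
-- adapted from Cruxes/AbelRegularity/Disproof.lean §0 (`guard_completion`, `abelRegularity_iff_witness` ⇒).
[cite: ButtaMarchioro2016, §2 Thm 2.1 and eq. (2.6)] [cite: Georgii2011, Thm 10.25 and §11.1] -/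
theorem witness_of_abelRegularity
    (h : _root_.Summit.AtomisticToContinuum.FouriersLaw.Theses.CoercivePulse.AbelRegularity) :
    ∀ ω₂ lam β : ℝ, 0 < ω₂ → 0 < lam → 0 < β → ∀ T : ℝ, 0 < T →
      ∃ (μ : MeasureTheory.Measure ChainConfig) (D : InfiniteChainDynamics (pinnedChain ω₂ lam β 1)),
        (pinnedChain ω₂ lam β 1).IsChainGibbsMeasure T μ ∧ IsShiftInvariant μ ∧ D.PreservesMeasure μ ∧
        ((∃ L : ℝ, Tendsto (fun ν : ℝ => ∫ t in Ioi (0:ℝ), Real.exp (-(ν * t)) * D.currentCorrelation μ t)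
            (𝓝[>] 0) (𝓝 L)) ∨
          Tendsto (fun ν : ℝ => ∫ t in Ioi (0:ℝ), Real.exp (-(ν * t)) * D.currentCorrelation μ t)
            (𝓝[>] 0) atTop) := by
  intro ω₂ lam β hω hl hβ T hT
  -- the transfer-operator state (shift-invariant, superstable) and the Buttà–Marchioro dynamics
  obtain ⟨μ, hG, hSI, hss⟩ :=
    OscillatorChain.exists_isChainGibbsMeasure_shiftInvariant_superstable_pinnedChain 1 hω hl.le hβ.le hT
  have hU2 : OscillatorChain.IsEvenPolyOfDegree (pinnedChain ω₂ lam β 1).U 2 :=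
    OscillatorChain.pinnedChain_isEvenPolyOfDegree_U β 1 hω.le hl
  have hV2 : OscillatorChain.IsEvenPolyOfDegree (pinnedChain ω₂ lam β 1).V 2 :=
    OscillatorChain.pinnedChain_isEvenPolyOfDegree_V ω₂ lam 1 hβ
  have hU0 : ∀ r, 0 ≤ (pinnedChain ω₂ lam β 1).U r := hU2.choose_spec.2.2
  have hV0 : ∀ r, 0 ≤ (pinnedChain ω₂ lam β 1).V r := hV2.choose_spec.2.2
  obtain ⟨D, hcar, -, -, -, -, -, hpres⟩ :=
    OscillatorChain.exists_bmDynamics (P := pinnedChain ω₂ lam β 1) (by norm_num) (by norm_num) hU2 hV2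
  have hP : D.PreservesMeasure μ := hpres T μ hG hss
  -- guard completion: reversal invariance (uniqueness), covariance (BM flow commutes with the shift on its good set)
  have huniq : ∀ μ₁ μ₂ : Measure ChainConfig,
      (pinnedChain ω₂ lam β 1).IsChainGibbsMeasure T μ₁ → IsShiftInvariant μ₁ →
      (pinnedChain ω₂ lam β 1).HasSuperstabilityEstimate μ₁ →
      (pinnedChain ω₂ lam β 1).IsChainGibbsMeasure T μ₂ → IsShiftInvariant μ₂ →
      (pinnedChain ω₂ lam β 1).HasSuperstabilityEstimate μ₂ → μ₁ = μ₂ :=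
    fun μ₁ μ₂ h₁ hS₁ _ h₂ hS₂ _ =>
      OscillatorChain.eq_of_isChainGibbsMeasure_of_isShiftInvariant_pinnedChain 1 hω hl.le hβ.le hT h₁ hS₁ h₂ hS₂
  have hrev : μ.map (fun σ : ChainConfig => fun x : ℤ => ((σ x).1, -(σ x).2)) = μ := by
    have h' := OscillatorChain.map_momentumReversalZ_eq_of_regular_unique hG hSI hss huniq
    rw [coe_momentumReversalZ] at h'
    exact h'
  have hmp : MeasurePreserving shift μ μ := ⟨shift_measurable, hSI⟩
  have hcov : ∀ t : ℝ, ∀ᵐ σ ∂μ, D.flow t (shift σ) = shift (D.flow t σ) := by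
    intro t
    have h2 := D.flow_comp_chainShift_ae_of_carrier_eq_bmGood hcar hU0 hV0 hP.1 t 1
    filter_upwards [h2] with σ hσ2
    rw [← chainShift_one]
    exact hσ2
  -- absolute convergence and Laplace integrability from the landed heat-variance calculus
  obtain ⟨hAC, -, hV⟩ := HeatVarianceCalculus.CanonicalRigidity.heatVarianceCalculus_proof ω₂ lam β 1 hω hl hβ T hT μ
    hG hSI hrev D hP hcov
  exact ⟨μ, D, hG, hSI, hP, h ω₂ lam β 1 hω hl hβ T hT μ hG hSI hrev D hP hcov hAC fun ν hν => ((hV _ rfl).2 ν hν).1⟩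

/-- **`AbelRegularity` ⟺ its witness form at bath constant `1`.** The crux is one assertion per `(ω₂, lam, β, T)` about
THE pinned anharmonic chain: non-oscillation at `ν ↓ 0` of the Abel means of its summed current autocorrelation.
-- adapted from Cruxes/AbelRegularity/Disproof.lean §0 (`abelRegularity_iff_witness`).
[cite: ButtaMarchioro2016, §2 Thm 2.1 and eq. (2.6)] [cite: Georgii2011, Thm 10.25 and §11.1] -/
theorem abelRegularity_iff_witness :
    _root_.Summit.AtomisticToContinuum.FouriersLaw.Theses.CoercivePulse.AbelRegularity ↔
      ∀ ω₂ lam β : ℝ, 0 < ω₂ → 0 < lam → 0 < β → ∀ T : ℝ, 0 < T →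
        ∃ (μ : MeasureTheory.Measure ChainConfig) (D : InfiniteChainDynamics (pinnedChain ω₂ lam β 1)),
          (pinnedChain ω₂ lam β 1).IsChainGibbsMeasure T μ ∧ IsShiftInvariant μ ∧ D.PreservesMeasure μ ∧
          ((∃ L : ℝ, Tendsto (fun ν : ℝ => ∫ t in Ioi (0:ℝ), Real.exp (-(ν * t)) * D.currentCorrelation μ t)
              (𝓝[>] 0) (𝓝 L)) ∨
            Tendsto (fun ν : ℝ => ∫ t in Ioi (0:ℝ), Real.exp (-(ν * t)) * D.currentCorrelation μ t)
              (𝓝[>] 0) atTop) :=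
  ⟨witness_of_abelRegularity, abelRegularity_of_witness⟩

end Summit.AtomisticToContinuum.FouriersLaw.Theorems.AbelRegularity.Sketch

end
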